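import Summits.ABC.IUTFork.Conditional.AbcOfSGenuineKTameRobustThirty
import HarnessLib

/-!
# Branch C / R-W lane P−·U: the [LIN] explicit-depth refutation made UNIFORM IN THE LOCAL TYPE at rational points —
# `d + a + b < B + 1 + 1/(p−2)` for EVERY place over a pole prime `p ∉ {2,3,5,l}` (`e ∣ 30·l`, `p ∤ e`), hence unconditional per-datum refutations

PROOF-ONLY file (no `def`, no new `Prop`, no instance) of the abc-iut cell (WAVE-5 prover seat abc-iut-w5-d107, gen 7; sequel of this seat's TameRobust
files p459701/p460144/p460892/p462147). TAKES NO SIDE on [IUTchIII] Cor. 3.12 or on any author. NO new engine: abc-iut-C-cert-1's per-datum [LIN] socket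
`GenuineK.not_pilotKummerCompatHull_chosen_of_explicit_depth` (p438886; this seat's route p437756: `p^{((i+2)(d+a+b))+1}·‖t_q(x₀)‖^{(i+1)²−1} < 1 ⇒ ¬S_H`)
is fed with a bound on the [IUTchIV] Prop. 1.1/1.2 constants `d, a, b` of `K_{x₀}` that holds for EVERY admissible local type at once:
* §1 `logRadiusB_le_of_lt_pow` (`e < p^B·(p−1) ⇒ b ≤ B − 1/e`) and `depthConstants_le_of_not_dvd_of_lt_pow` (`p ∤ e`, `e < p^B·(p−1)` ⇒
  `d + a + b ≤ B + 1 + 1/(p−2) − 1/e`; `d = (e−1)/e` by `differentOrd_eq_of_not_dvd`, `a ≤ 1/(p−2) + 1/e`);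
* §2 `GenuineK.not_pilotKummerCompatHull_chosen_ratPoint_of_linUniform` — `λ ∈ ℚ`, `T` at `(ratPoint λ, l)`, a prime `p ∉ {2, 3, 5, l}` with
  `ord_p j(λ) ≤ −h`, an integer `B` with `30·l < p^B·(p−1)`, a label `i₀ + 1 ≤ l⋆` with the INTEGER TEST
  **`2l·((i₀+2)·((B+1)(p−2)+1) + (p−2)) ≤ h·i₀(i₀+2)·(p−2)`** (i.e. `(i₀+2)(B+1+1/(p−2)) + 1 ≤ (h/2l)·((i₀+1)²−1)`) ⇒ ¬ S_H at EVERY genuine Θ-volume datum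
  over `(ratPoint λ, l)` — NO local hypothesis: every `x₀ | p` has `e ∣ 30·l` and `p ∤ e` by abc-iut-W-neg-1's local-type lemmas (p459442, `…thirty…`
  `ramificationIdx_int_dvd_thirty_mul_ratPoint'`), so `e ≤ 30·l < p^B(p−1)` and §1 applies, while `‖t_q(x₀)‖ ≤ p^{−h/(2l)}` (abc-iut-w4-d026 p442760);
* §3 `GenuineK.not_pilotKummerCompatHull_chosen_triple_of_linUniform` — abc-TRIPLE form (`λ = a/c`, `p^v ∣ abc`, `h = 2v`).
In the R-W numerics lead's table (HOME/plan/rescue/R-W/TARGETS.tsv) this test, together with the robust tame test of the parents, passes at 111 of the 125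
(datum, l) pairs — desk count; the per-row instantiations are filed separately.

HONEST SCOPE as in the parents: SHARP reading (Θ-possible-image set constant in `m`, typed (Ind1)/(Ind2) = Dupuy–Hilado families); per-label licence STRONGER
than print; admissibility / Szpiro-badness / (P6) / non-emptiness of the datum type NOT claimed; «refuted as typed» ≠ «refuted in print»; nothing about
the number-level Corollary; typed ≠ proved; instantiated ≠ endorsed. [cite: Mochizuki2012, IUTchIII Cor. 3.12 Step (xi-f) p. 184; IUTchIV Prop. 1.1 p. 9, Prop. 1.2 p. 10, Cor. 2.2 (ii) proof p. 44–46]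
[cite: SerreLocalFields1979, Ch. III §6 Prop. 13, Ch. IV §2 Cor. 1 of Prop. 7] [cite: DupuyHilado2025, §3.3, §3.4, §4.10] [cite: MochizukiGenEll2010, Thm. 2.1 p. 11]
[claim: Mochizuki2012, status: disputed] for every IUT sentence quoted.
-/

noncomputable section

open Set Function NumberField IsDedekindDomain

/-! ## §1. The Prop. 1.2 constants, uniform in the local type -/

namespace Literature.IUT.LogVolume

section LocalType

variable (p : ℕ) [Fact p.Prime] (K' : Type) [NontriviallyNormedField K'] [NormedAlgebra ℚ_[p] K']
  [IsUltrametricDist K'] [ProperSpace K']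

omit [Fact p.Prime] in
/-- **`b ≤ B − 1/e` whenever `e < p^B·(p − 1)`** (`b = ⌊log(pe/(p−1))/log p⌋ − 1/e`, and `pe/(p−1) < p^{B+1}`). [cite: Mochizuki2012, IUTchIV Prop. 1.2 p. 10]
[claim: Mochizuki2012, status: disputed] -/
theorem logRadiusB_le_of_lt_pow (hp2 : 2 < p) {e B : ℕ} (he : 0 < e) (hlt : e < p ^ B * (p - 1)) :
    logRadiusB p e ≤ (B : ℝ) - 1 / e := by
  have hp1 : (1 : ℝ) < p := by exact_mod_cast (lt_trans (by norm_num) hp2 : 1 < p)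
  have hp0 : (0 : ℝ) < p := by positivity
  have hlogp : 0 < Real.log p := Real.log_pos hp1
  have hp1' : (0 : ℝ) < (p : ℝ) - 1 := by linarith
  have he' : (0 : ℝ) < e := by exact_mod_cast he
  have hlt' : (e : ℝ) < (p : ℝ) ^ B * ((p : ℝ) - 1) := by
    have h1 : ((p ^ B * (p - 1) : ℕ) : ℝ) = (p : ℝ) ^ B * ((p : ℝ) - 1) := by
      rw [Nat.cast_mul, Nat.cast_pow, Nat.cast_sub (by omega : 1 ≤ p), Nat.cast_one]
    rw [← h1]; exact_mod_cast hlt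
  have hx : (p : ℝ) * e / ((p : ℝ) - 1) < (p : ℝ) ^ (B + 1) := by
    rw [div_lt_iff₀ hp1', pow_succ]
    nlinarith
  have hxpos : 0 < (p : ℝ) * e / ((p : ℝ) - 1) := by positivity
  have hlog : Real.log ((p : ℝ) * e / ((p : ℝ) - 1)) < ((B : ℝ) + 1) * Real.log p := by
    have := Real.log_lt_log hxpos hx
    rw [Real.log_pow] at this
    push_cast at this
    linarith
  have hfloor : ⌊Real.log ((p : ℝ) * e / ((p : ℝ) - 1)) / Real.log p⌋ < (B : ℤ) + 1 := by
    rw [Int.floor_lt]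
    push_cast
    rw [div_lt_iff₀ hlogp]
    linarith
  have hfl : (⌊Real.log ((p : ℝ) * e / ((p : ℝ) - 1)) / Real.log p⌋ : ℝ) ≤ B := by
    have : ⌊Real.log ((p : ℝ) * e / ((p : ℝ) - 1)) / Real.log p⌋ ≤ (B : ℤ) := Int.lt_add_one_iff.mp hfloor
    exact_mod_cast this
  rw [logRadiusB]
  linarith

/-- **`d + a + b ≤ B + 1 + 1/(p−2) − 1/e`** for a `p`-adic field with `p ∤ e` (`d = (e−1)/e`, Serre III §6 Prop. 13) and `e < p^B·(p−1)`
(`a ≤ 1/(p−2) + 1/e`, `b ≤ B − 1/e`) — a bound on the [IUTchIV] Prop. 1.1/1.2 constants UNIFORM in the ramification index below `p^B(p−1)`.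
[cite: Mochizuki2012, IUTchIV Prop. 1.2 p. 10] [cite: SerreLocalFields1979, Ch. III §6 Prop. 13] [claim: Mochizuki2012, status: disputed] -/
theorem depthConstants_le_of_not_dvd_of_lt_pow (hp2 : 2 < p) (htame : ¬ p ∣ absRamificationIdx p K') {B : ℕ}
    (hlt : absRamificationIdx p K' < p ^ B * (p - 1)) :
    differentOrd p K' + logRadiusA p (absRamificationIdx p K') + logRadiusB p (absRamificationIdx p K') ≤
      (B : ℝ) + 1 + 1 / ((p : ℝ) - 2) - 1 / (absRamificationIdx p K' : ℝ) := by
  set e := absRamificationIdx p K' with he_def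
  have he : 0 < e := absRamificationIdx_pos p K'
  have he' : (0 : ℝ) < e := by exact_mod_cast he
  have hd : differentOrd p K' = ((e : ℝ) - 1) / e := differentOrd_eq_of_not_dvd p K' htame
  have ha := logRadiusA_le p hp2 he
  have hb := logRadiusB_le_of_lt_pow p hp2 he hlt
  have hd' : ((e : ℝ) - 1) / e = 1 - 1 / e := by field_simp
  rw [hd, hd']
  linarith

end LocalType

end Literature.IUT.LogVolume

/-! ## §2. Rational points: the [LIN] refutation, uniform in the local type -/

namespace Summit.ABC.IUTFork.Conditional

open Thm311 Thm311.Real Cor312 Cor312Vol Cor312Prov Literature.IUT.LogThetaLattice Literature.IUT.LogVolume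
  Literature.IUT.HodgeTheaters Literature.IUT.LogVolume.ThetaData Literature.IUT.LogVolume.Cor22
open Literature.NumberTheory.NumberFields Literature.NumberTheory.GaloisRepresentations.Ultrametric
open Literature.NumberTheory.DiophantineGeometry Literature.NumberTheory.DiophantineGeometry.GenEll Summit.ABC.ABC.Theorems

/-- **UNCONDITIONAL [LIN] REFUTATION AT A RATIONAL POINT, UNIFORM IN THE LOCAL TYPE.** `λ ∈ ℚ`, `T` a genuine Θ-volume datum at `(ratPoint λ, l)`,
`p ∉ {2, 3, 5, l}` a prime at which `j(λ)` has a pole of order `≥ h ≥ 1`, `B : ℕ` with `30·l < p^B·(p−1)`, a label `j = i₀+1 ≤ l⋆` with the integer test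
**`2l·((i₀+2)·((B+1)(p−2)+1) + (p−2)) ≤ h·i₀(i₀+2)·(p−2)`**. THEN the hull-level clause S_H (chosen realising ideles, pinned reading) FAILS for every
choice of the free context binders and Kummer datum: at any `x₀ | p` (bad, `‖t_q(x₀)‖ ≤ p^{−h/(2l)}` — abc-iut-w4-d026), `e ∣ 30·l`, `p ∤ e` (abc-iut-W-neg-1)
give `d + a + b < B + 1 + 1/(p−2)` (§1), so `p^{((i₀+2)(d+a+b))+1}·‖t_q(x₀)‖^{(i₀+1)²−1} < 1` and abc-iut-C-cert-1's p438886 fires.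
[cite: Mochizuki2012, IUTchIV Prop. 1.2 p. 10, Cor. 2.2 (ii) proof (P5) p. 46; IUTchIII Cor. 3.12 Step (xi-f) p. 184] [claim: Mochizuki2012, status: disputed] -/
theorem GenuineK.not_pilotKummerCompatHull_chosen_ratPoint_of_linUniform {q : ℚ} {l : ℕ}
    (T : Cor22.ThetaVolumeDatumAt (ratPoint q) l) (pp : Nat.Primes) (hp2 : (pp : ℕ) ≠ 2) (hp3 : (pp : ℕ) ≠ 3) (hp5 : (pp : ℕ) ≠ 5)
    (hpl : (pp : ℕ) ≠ l) (B : ℕ) (hB : 30 * l < (pp : ℕ) ^ B * ((pp : ℕ) - 1)) (h : ℕ) (hh : 1 ≤ h)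
    (hord : ∀ u : HeightOneSpectrum (𝓞 ℚ), Rat.HeightOneSpectrum.natGenerator u = (pp : ℕ) → ord ℚ u (Cor22.jInv q) ≤ -(h : ℤ))
    (i₀ : ℕ) (hil : i₀ + 1 ≤ (l - 1) / 2)
    (htest : 2 * l * ((i₀ + 2) * ((B + 1) * ((pp : ℕ) - 2) + 1) + ((pp : ℕ) - 2)) ≤ h * (i₀ * (i₀ + 2)) * ((pp : ℕ) - 2)) :
    letI := T.instFieldF; letI := T.instNumberFieldF; letI := T.instAlgebraF; letI := T.instFieldK
    letI := T.instNumberFieldK; letI := T.instAlgebraK; letI := T.instFieldFbar; letI := T.instAlgebraFbar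
    letI := T.instAlgebraKFbar; letI := T.instIsElliptic
    haveI : Fact (pp : ℕ).Prime := ⟨pp.2⟩
    ∀ (M : Type) [Field M] [NumberField M]
      (archPk : ∀ (j : (thetaIndex (pilotDataOfK T.D T.K)).Label) (vQ : (thetaIndex (pilotDataOfK T.D T.K)).VQ),
        Set ((logShellsDH (pilotDataOfK T.D T.K) (analyticLogv T.K)).Packet j vQ))
      (archSub : ∀ (j : (thetaIndex (pilotDataOfK T.D T.K)).Label) (v : (thetaIndex (pilotDataOfK T.D T.K)).V),
        Set ((logShellsDH (pilotDataOfK T.D T.K) (analyticLogv T.K)).Packet j ((thetaIndex (pilotDataOfK T.D T.K)).over v)))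
      (Ψ : ℤ → ∀ v : (thetaIndex (pilotDataOfK T.D T.K)).V, v ∈ (thetaIndex (pilotDataOfK T.D T.K)).Vbad →
        Set ((logShellsDH (pilotDataOfK T.D T.K) (analyticLogv T.K)).StarPacket v))
      (act : ℤ → ∀ v : (thetaIndex (pilotDataOfK T.D T.K)).V, v ∈ (thetaIndex (pilotDataOfK T.D T.K)).Vbad →
        (logShellsDH (pilotDataOfK T.D T.K) (analyticLogv T.K)).StarPacket v →
          Module.End ℚ ((logShellsDH (pilotDataOfK T.D T.K) (analyticLogv T.K)).StarPacket v))
      (Mmod : ℤ → ∀ j : (thetaIndex (pilotDataOfK T.D T.K)).LabelStar, Set ((logShellsDH (pilotDataOfK T.D T.K) (analyticLogv T.K)).GlobalPacket j.1))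
      (region : ℤ → ∀ j : (thetaIndex (pilotDataOfK T.D T.K)).LabelStar, FinDivisor M → ∀ vQ : (thetaIndex (pilotDataOfK T.D T.K)).VQ,
        Set ((logShellsDH (pilotDataOfK T.D T.K) (analyticLogv T.K)).Packet j.1 vQ))
      (frobAdm : ℤ → ℤ → ∀ (j : (thetaIndex (pilotDataOfK T.D T.K)).Label) (vQ : (thetaIndex (pilotDataOfK T.D T.K)).VQ),
        Set ((logShellsDH (pilotDataOfK T.D T.K) (analyticLogv T.K)).Packet j vQ) → Prop)
      (frobLogvol : ℤ → ℤ → ∀ (j : (thetaIndex (pilotDataOfK T.D T.K)).Label) (vQ : (thetaIndex (pilotDataOfK T.D T.K)).VQ),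
        Set ((logShellsDH (pilotDataOfK T.D T.K) (analyticLogv T.K)).Packet j vQ) → ℝ)
      (frobΨ : ℤ → ℤ → ∀ v : (thetaIndex (pilotDataOfK T.D T.K)).V, v ∈ (thetaIndex (pilotDataOfK T.D T.K)).Vbad →
        Set ((logShellsDH (pilotDataOfK T.D T.K) (analyticLogv T.K)).StarPacket v))
      (frobMmod : ℤ → ℤ → ∀ j : (thetaIndex (pilotDataOfK T.D T.K)).LabelStar, Set ((logShellsDH (pilotDataOfK T.D T.K) (analyticLogv T.K)).GlobalPacket j.1))
      (unitImage : ℤ → ℤ → ℕ → ∀ (j : (thetaIndex (pilotDataOfK T.D T.K)).Label) (vQ : (thetaIndex (pilotDataOfK T.D T.K)).VQ),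
        Set ((logShellsDH (pilotDataOfK T.D T.K) (analyticLogv T.K)).Packet j vQ))
      (ballImage : ℤ → ℤ → ∀ (j : (thetaIndex (pilotDataOfK T.D T.K)).Label) (vQ : (thetaIndex (pilotDataOfK T.D T.K)).VQ),
        Set ((logShellsDH (pilotDataOfK T.D T.K) (analyticLogv T.K)).Packet j vQ))
      (thetaDiv : ℤ → ℤ → LgpDivisor M (thetaIndex (pilotDataOfK T.D T.K)).lstar)
      (n : ℤ) {HT : Type} {LogLink : HT → HT → Type} {IsFull : ∀ {s t : HT}, LogLink s t → Prop}
      (lat : LGPGaussianLogThetaLattice LogLink IsFull)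
      {Frd : Type} {IsoF : Frd → Frd → Type} {Ob : Frd → Type} {realify : Frd → Frd} {Strip : Type}
      {IsoS : Strip → Strip → Type} {Mv : ∀ v : (thetaIndex (pilotDataOfK T.D T.K)).V, v ∈ (thetaIndex (pilotDataOfK T.D T.K)).Vbad → Type}
      [∀ v h, Monoid (Mv v h)]
      (sig : GlobalLGPFrobenioidSignature (thetaIndex (pilotDataOfK T.D T.K)).lstar (thetaIndex (pilotDataOfK T.D T.K)).V
        (· ∈ (thetaIndex (pilotDataOfK T.D T.K)).Vbad) Frd IsoF Ob realify Strip IsoS Mv)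
      (split : SplittingMonoids Mv) {ObΔ : Type} {N : ∀ v : (thetaIndex (pilotDataOfK T.D T.K)).V, v ∈ (thetaIndex (pilotDataOfK T.D T.K)).Vbad → Type}
      [∀ v h, Monoid (N v h)] (qData : QPilotData ObΔ N)
      (qK : ∀ v : (thetaIndex (pilotDataOfK T.D T.K)).V, v ∈ (thetaIndex (pilotDataOfK T.D T.K)).Vbad →
        Set ((logShellsDH (pilotDataOfK T.D T.K) (analyticLogv T.K)).StarPacket v)),
      ¬ Cor312Vol.PilotKummerCompatHull
          (LatticeSituation.ofShells (logShellsDH (pilotDataOfK T.D T.K) (analyticLogv T.K)) M archPk archSub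
            (summandPiecesPr (pilotDataOfK T.D T.K) (logvAnalytic_analyticLogv (F := T.K))).Adm
            (summandPiecesPr (pilotDataOfK T.D T.K) (logvAnalytic_analyticLogv (F := T.K))).logvol Ψ act Mmod region frobAdm frobLogvol frobΨ
            frobMmod unitImage ballImage thetaDiv)
          (settingPrVolSharp (pilotDataOfK T.D T.K) (logvAnalytic_analyticLogv (F := T.K)) M archPk archSub Ψ act Mmod region n lat sig split qData
            (exists_realising_qIdeles_pilotDataOfK T.D).choose (exists_realising_thetaIdeles_pilotDataOfK T.D).choose
            (exists_realising_qIdeles_pilotDataOfK T.D).choose_spec.1 (exists_realising_qIdeles_pilotDataOfK T.D).choose_spec.2.1)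
          (fun _ => Cor312.Setting.qRegion
            (settingPrVolSharp (pilotDataOfK T.D T.K) (logvAnalytic_analyticLogv (F := T.K)) M archPk archSub Ψ act Mmod region n lat sig split qData
              (exists_realising_qIdeles_pilotDataOfK T.D).choose (exists_realising_thetaIdeles_pilotDataOfK T.D).choose
              (exists_realising_qIdeles_pilotDataOfK T.D).choose_spec.1 (exists_realising_qIdeles_pilotDataOfK T.D).choose_spec.2.1)) qK := by
  classical
  letI := T.instFieldF; letI := T.instNumberFieldF; letI := T.instAlgebraF; letI := T.instFieldK
  letI := T.instNumberFieldK; letI := T.instAlgebraK; letI := T.instFieldFbar; letI := T.instAlgebraFbar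
  letI := T.instAlgebraKFbar; letI := T.instIsElliptic
  haveI : Fact (pp : ℕ).Prime := ⟨pp.2⟩
  intro M _ _ archPk archSub Ψ act Mmod region frobAdm frobLogvol frobΨ frobMmod unitImage ballImage thetaDiv n HT LogLink IsFull lat
    Frd IsoF Ob realify Strip IsoS Mv _ sig split ObΔ N _ qData qK
  obtain ⟨v, hv⟩ := (thetaIndex (pilotDataOfK T.D T.K)).fibre_nonempty (.inr pp)
  set x₀ : (thetaIndex (pilotDataOfK T.D T.K)).Fibre (.inr pp) := ⟨v, hv⟩ with hx₀def
  -- the label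
  have hlstar : (thetaIndex (pilotDataOfK T.D T.K)).lstar = (l - 1) / 2 := by
    show ((pilotDataOfK T.D T.K).l - 1) / 2 = (l - 1) / 2
    rw [pilotDataOfK_l]
  have hlt : i₀ < (thetaIndex (pilotDataOfK T.D T.K)).lstar := by rw [hlstar]; omega
  have hl5 : 5 ≤ l := T.D.five_le_l
  -- the prime
  obtain ⟨p', hp'⟩ : ∃ p', (pp : ℕ) = p' + 3 := ⟨(pp : ℕ) - 3, by have := pp.2.two_le; omega⟩
  have hp2' : 2 < (pp : ℕ) := by omega
  have hp0 : (0 : ℝ) < ((pp : ℕ) : ℝ) := by exact_mod_cast pp.2.pos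
  have hp1 : (1 : ℝ) < ((pp : ℕ) : ℝ) := by exact_mod_cast pp.2.one_lt
  -- `x₀` is bad and `‖t_q(x₀)‖ ≤ p^{−h/(2l)}` (abc-iut-w4-d026)
  obtain ⟨-, hnorm⟩ := norm_chosenQIdele_le_rpow_of_ratPoint' T.D q T.j_eq T.isP5Choice pp x₀ hp2 hpl h hh hord
  -- local type at `x₀`: `e ∣ 30·l`, `p ∤ e` (abc-iut-W-neg-1)
  have hpole : ∀ u : HeightOneSpectrum (𝓞 ℚ), Rat.HeightOneSpectrum.natGenerator u = (pp : ℕ) → ord ℚ u (Cor22.jInv q) < 0 :=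
    fun u hu => lt_of_le_of_lt (hord u hu) (by omega)
  have hnot : (pp : ℕ) ∉ ({2, 3, 5, l} : Finset ℕ) := by
    simp only [Finset.mem_insert, Finset.mem_singleton, not_or]
    exact ⟨hp2, hp3, hp5, hpl⟩
  set w := placeOf (pilotDataOfK T.D T.K) pp.1 x₀ with hwdef
  have hpw : ((pp : ℕ) : 𝓞 T.K) ∈ w.asIdeal := natCast_mem_placeOf (pilotDataOfK T.D T.K) pp.1 x₀
  have hwchar : residueChar T.K w = (pp : ℕ) := residueChar_eq_of_natCast_mem pp.1 hpw
  have hdvd : w.asIdeal.ramificationIdx ℤ ∣ 30 * l := T.ramificationIdx_int_dvd_thirty_mul_ratPoint' hnot hpole w hwchar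
  obtain ⟨-, hndvd⟩ := GenuineK.absRamificationIdx_kOf_dvd_ratPoint T pp hp2 hp3 hp5 hpl hpole x₀
  set e : ℕ := absRamificationIdx (pp : ℕ) (kOf (pilotDataOfK T.D T.K) pp.1 x₀) with hedef
  have heK : e = w.asIdeal.ramificationIdx ℤ := absRamificationIdx_rescaledCompletion T.K (pp : ℕ) w hpw
  have he0 : 0 < e := absRamificationIdx_pos (pp : ℕ) _
  have hel : e < (pp : ℕ) ^ B * ((pp : ℕ) - 1) := by
    have : e ≤ 30 * l := by rw [heK]; exact Nat.le_of_dvd (by omega) hdvd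
    omega
  -- the uniform bound on the Prop. 1.2 constants of `K_{x₀}`
  have hdab := depthConstants_le_of_not_dvd_of_lt_pow (pp : ℕ) (kOf (pilotDataOfK T.D T.K) pp.1 x₀) hp2' hndvd hel
  set dab : ℝ := differentOrd (pp : ℕ) (kOf (pilotDataOfK T.D T.K) pp.1 x₀) + logRadiusA (pp : ℕ) e + logRadiusB (pp : ℕ) e with hdabdef
  have he' : (0 : ℝ) < (e : ℝ) := by exact_mod_cast he0
  have h1e : 0 < 1 / (e : ℝ) := by positivity
  have hp2r : (0 : ℝ) < ((pp : ℕ) : ℝ) - 2 := by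
    have : (2 : ℝ) < ((pp : ℕ) : ℝ) := by exact_mod_cast hp2'
    linarith
  have hl0 : (0 : ℝ) < (l : ℝ) := by exact_mod_cast (show 0 < l by omega)
  have hi0 : (0 : ℝ) < (i₀ : ℝ) + 2 := by positivity
  -- the integer test, read over `ℝ`: `(i₀+2)·(B + 1 + 1/(p−2)) + 1 ≤ (h/2l)·i₀(i₀+2)`
  have htestR : ((i₀ : ℝ) + 2) * ((B : ℝ) + 1 + 1 / (((pp : ℕ) : ℝ) - 2)) + 1 ≤
      (h : ℝ) / (2 * l) * ((i₀ : ℝ) * ((i₀ : ℝ) + 2)) := by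
    have hc : (((pp : ℕ) : ℝ) - 2) = (p' : ℝ) + 1 := by rw [hp']; push_cast; ring
    have key : (2 * (l : ℝ)) * (((i₀ : ℝ) + 2) * (((B : ℝ) + 1) * ((p' : ℝ) + 1) + 1) + ((p' : ℝ) + 1)) ≤
        (h : ℝ) * ((i₀ : ℝ) * ((i₀ : ℝ) + 2)) * ((p' : ℝ) + 1) := by
      have h1 : (pp : ℕ) - 2 = p' + 1 := by omega
      rw [h1] at htest
      exact_mod_cast htest
    rw [hc]
    rw [show ((i₀ : ℝ) + 2) * ((B : ℝ) + 1 + 1 / ((p' : ℝ) + 1)) + 1 =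
        ((2 * (l : ℝ)) * (((i₀ : ℝ) + 2) * (((B : ℝ) + 1) * ((p' : ℝ) + 1) + 1) + ((p' : ℝ) + 1))) /
          ((2 * (l : ℝ)) * ((p' : ℝ) + 1)) by field_simp]
    rw [show (h : ℝ) / (2 * l) * ((i₀ : ℝ) * ((i₀ : ℝ) + 2)) =
        ((h : ℝ) * ((i₀ : ℝ) * ((i₀ : ℝ) + 2)) * ((p' : ℝ) + 1)) / ((2 * (l : ℝ)) * ((p' : ℝ) + 1)) by field_simp]
    exact div_le_div_of_nonneg_right key (by positivity)
  -- the exponent: `(i₀+2)·dab + 1 < (h/2l)·((i₀+1)²−1)`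
  have hA : ((i₀ : ℝ) + 2) * dab + 1 < (h : ℝ) / (2 * l) * ((i₀ : ℝ) * ((i₀ : ℝ) + 2)) := by
    have h1 : ((i₀ : ℝ) + 2) * dab ≤ ((i₀ : ℝ) + 2) * ((B : ℝ) + 1 + 1 / (((pp : ℕ) : ℝ) - 2) - 1 / (e : ℝ)) :=
      mul_le_mul_of_nonneg_left hdab hi0.le
    nlinarith [mul_pos hi0 h1e]
  -- assemble `hdeep`
  set τ : ℝ := ‖(exists_realising_qIdeles_pilotDataOfK T.D).choose pp x₀‖ with hτdef
  have hτ0 : 0 ≤ τ := norm_nonneg _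
  have hn : (i₀ + 1) ^ 2 - 1 = i₀ * (i₀ + 2) := by
    have : (i₀ + 1) ^ 2 = i₀ * (i₀ + 2) + 1 := by ring
    omega
  have hpow : τ ^ ((i₀ + 1) ^ 2 - 1) ≤ ((pp : ℕ) : ℝ) ^ ((-(h : ℝ) / (2 * l)) * ((i₀ : ℝ) * ((i₀ : ℝ) + 2))) := by
    rw [hn]
    calc τ ^ (i₀ * (i₀ + 2)) ≤ ((((pp : ℕ) : ℝ)) ^ (-(h : ℝ) / (2 * l))) ^ (i₀ * (i₀ + 2)) := pow_le_pow_left₀ hτ0 hnorm _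
      _ = ((pp : ℕ) : ℝ) ^ ((-(h : ℝ) / (2 * l)) * ((i₀ : ℝ) * ((i₀ : ℝ) + 2))) := by
          rw [← Real.rpow_natCast, ← Real.rpow_mul hp0.le]
          push_cast
          ring_nf
  have hdeep : ((pp : ℕ) : ℝ) ^ ((((i₀ : ℕ) : ℝ) + 2) * dab + 1) * τ ^ (((i₀ : ℕ) + 1) ^ 2 - 1) < 1 := by
    have hApos : 0 < ((pp : ℕ) : ℝ) ^ ((((i₀ : ℕ) : ℝ) + 2) * dab + 1) := Real.rpow_pos_of_pos hp0 _
    calc ((pp : ℕ) : ℝ) ^ ((((i₀ : ℕ) : ℝ) + 2) * dab + 1) * τ ^ (((i₀ : ℕ) + 1) ^ 2 - 1)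
        ≤ ((pp : ℕ) : ℝ) ^ ((((i₀ : ℕ) : ℝ) + 2) * dab + 1) *
            ((pp : ℕ) : ℝ) ^ ((-(h : ℝ) / (2 * l)) * ((i₀ : ℝ) * ((i₀ : ℝ) + 2))) := mul_le_mul_of_nonneg_left hpow hApos.le
      _ = ((pp : ℕ) : ℝ) ^ ((((i₀ : ℕ) : ℝ) + 2) * dab + 1 + (-(h : ℝ) / (2 * l)) * ((i₀ : ℝ) * ((i₀ : ℝ) + 2))) :=
          (Real.rpow_add hp0 _ _).symm
      _ < ((pp : ℕ) : ℝ) ^ (0 : ℝ) := by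
          apply Real.rpow_lt_rpow_of_exponent_lt hp1
          have : (-(h : ℝ) / (2 * l)) * ((i₀ : ℝ) * ((i₀ : ℝ) + 2)) = -((h : ℝ) / (2 * l) * ((i₀ : ℝ) * ((i₀ : ℝ) + 2))) := by ring
          rw [this]
          linarith
      _ = 1 := Real.rpow_zero _
  exact GenuineK.not_pilotKummerCompatHull_chosen_of_explicit_depth T.D M archPk archSub Ψ act Mmod region frobAdm frobLogvol frobΨ
    frobMmod unitImage ballImage thetaDiv n lat sig split qData qK pp ⟨i₀, hlt⟩ x₀ hdeep

/-- **abc-TRIPLE form.** `a + b = c` coprime, `λ = a/c`, a prime `p ∉ {2, 3, 5, l}`, `B` with `30·l < p^B·(p−1)`, `p^v ∣ abc` (`v ≥ 1`), a label `i₀ + 1 ≤ l⋆`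
with **`2l·((i₀+2)·((B+1)(p−2)+1) + (p−2)) ≤ 2v·i₀(i₀+2)·(p−2)`** ⇒ ¬ S_H at every genuine Θ-volume datum over `(ratPoint (a/c), l)` — unconditionally.
[cite: MochizukiGenEll2010, Thm. 2.1 p. 11] [cite: Mochizuki2012, IUTchIV Cor. 2.2 (ii) proof p. 44; IUTchIII Cor. 3.12 Step (xi-f) p. 184]
[claim: Mochizuki2012, status: disputed] -/
theorem GenuineK.not_pilotKummerCompatHull_chosen_triple_of_linUniform {a b c : ℕ} (habc : IsABCTriple a b c) {l : ℕ}
    (T : Cor22.ThetaVolumeDatumAt (ratPoint ((a : ℚ) / c)) l) (pp : Nat.Primes) (hp2 : (pp : ℕ) ≠ 2) (hp3 : (pp : ℕ) ≠ 3)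
    (hp5 : (pp : ℕ) ≠ 5) (hpl : (pp : ℕ) ≠ l) (B : ℕ) (hB : 30 * l < (pp : ℕ) ^ B * ((pp : ℕ) - 1)) (v : ℕ) (hv : 1 ≤ v)
    (hdvd : (pp : ℕ) ^ v ∣ a * b * c) (i₀ : ℕ) (hil : i₀ + 1 ≤ (l - 1) / 2)
    (htest : 2 * l * ((i₀ + 2) * ((B + 1) * ((pp : ℕ) - 2) + 1) + ((pp : ℕ) - 2)) ≤ 2 * v * (i₀ * (i₀ + 2)) * ((pp : ℕ) - 2)) :
    letI := T.instFieldF; letI := T.instNumberFieldF; letI := T.instAlgebraF; letI := T.instFieldK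
    letI := T.instNumberFieldK; letI := T.instAlgebraK; letI := T.instFieldFbar; letI := T.instAlgebraFbar
    letI := T.instAlgebraKFbar; letI := T.instIsElliptic
    ∀ (M : Type) [Field M] [NumberField M]
      (archPk : ∀ (j : (thetaIndex (pilotDataOfK T.D T.K)).Label) (vQ : (thetaIndex (pilotDataOfK T.D T.K)).VQ),
        Set ((logShellsDH (pilotDataOfK T.D T.K) (analyticLogv T.K)).Packet j vQ))
      (archSub : ∀ (j : (thetaIndex (pilotDataOfK T.D T.K)).Label) (v : (thetaIndex (pilotDataOfK T.D T.K)).V),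
        Set ((logShellsDH (pilotDataOfK T.D T.K) (analyticLogv T.K)).Packet j ((thetaIndex (pilotDataOfK T.D T.K)).over v)))
      (Ψ : ℤ → ∀ v : (thetaIndex (pilotDataOfK T.D T.K)).V, v ∈ (thetaIndex (pilotDataOfK T.D T.K)).Vbad →
        Set ((logShellsDH (pilotDataOfK T.D T.K) (analyticLogv T.K)).StarPacket v))
      (act : ℤ → ∀ v : (thetaIndex (pilotDataOfK T.D T.K)).V, v ∈ (thetaIndex (pilotDataOfK T.D T.K)).Vbad →
        (logShellsDH (pilotDataOfK T.D T.K) (analyticLogv T.K)).StarPacket v →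
          Module.End ℚ ((logShellsDH (pilotDataOfK T.D T.K) (analyticLogv T.K)).StarPacket v))
      (Mmod : ℤ → ∀ j : (thetaIndex (pilotDataOfK T.D T.K)).LabelStar, Set ((logShellsDH (pilotDataOfK T.D T.K) (analyticLogv T.K)).GlobalPacket j.1))
      (region : ℤ → ∀ j : (thetaIndex (pilotDataOfK T.D T.K)).LabelStar, FinDivisor M → ∀ vQ : (thetaIndex (pilotDataOfK T.D T.K)).VQ,
        Set ((logShellsDH (pilotDataOfK T.D T.K) (analyticLogv T.K)).Packet j.1 vQ))
      (frobAdm : ℤ → ℤ → ∀ (j : (thetaIndex (pilotDataOfK T.D T.K)).Label) (vQ : (thetaIndex (pilotDataOfK T.D T.K)).VQ),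
        Set ((logShellsDH (pilotDataOfK T.D T.K) (analyticLogv T.K)).Packet j vQ) → Prop)
      (frobLogvol : ℤ → ℤ → ∀ (j : (thetaIndex (pilotDataOfK T.D T.K)).Label) (vQ : (thetaIndex (pilotDataOfK T.D T.K)).VQ),
        Set ((logShellsDH (pilotDataOfK T.D T.K) (analyticLogv T.K)).Packet j vQ) → ℝ)
      (frobΨ : ℤ → ℤ → ∀ v : (thetaIndex (pilotDataOfK T.D T.K)).V, v ∈ (thetaIndex (pilotDataOfK T.D T.K)).Vbad →
        Set ((logShellsDH (pilotDataOfK T.D T.K) (analyticLogv T.K)).StarPacket v))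
      (frobMmod : ℤ → ℤ → ∀ j : (thetaIndex (pilotDataOfK T.D T.K)).LabelStar, Set ((logShellsDH (pilotDataOfK T.D T.K) (analyticLogv T.K)).GlobalPacket j.1))
      (unitImage : ℤ → ℤ → ℕ → ∀ (j : (thetaIndex (pilotDataOfK T.D T.K)).Label) (vQ : (thetaIndex (pilotDataOfK T.D T.K)).VQ),
        Set ((logShellsDH (pilotDataOfK T.D T.K) (analyticLogv T.K)).Packet j vQ))
      (ballImage : ℤ → ℤ → ∀ (j : (thetaIndex (pilotDataOfK T.D T.K)).Label) (vQ : (thetaIndex (pilotDataOfK T.D T.K)).VQ),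
        Set ((logShellsDH (pilotDataOfK T.D T.K) (analyticLogv T.K)).Packet j vQ))
      (thetaDiv : ℤ → ℤ → LgpDivisor M (thetaIndex (pilotDataOfK T.D T.K)).lstar)
      (n : ℤ) {HT : Type} {LogLink : HT → HT → Type} {IsFull : ∀ {s t : HT}, LogLink s t → Prop}
      (lat : LGPGaussianLogThetaLattice LogLink IsFull)
      {Frd : Type} {IsoF : Frd → Frd → Type} {Ob : Frd → Type} {realify : Frd → Frd} {Strip : Type}
      {IsoS : Strip → Strip → Type} {Mv : ∀ v : (thetaIndex (pilotDataOfK T.D T.K)).V, v ∈ (thetaIndex (pilotDataOfK T.D T.K)).Vbad → Type}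
      [∀ v h, Monoid (Mv v h)]
      (sig : GlobalLGPFrobenioidSignature (thetaIndex (pilotDataOfK T.D T.K)).lstar (thetaIndex (pilotDataOfK T.D T.K)).V
        (· ∈ (thetaIndex (pilotDataOfK T.D T.K)).Vbad) Frd IsoF Ob realify Strip IsoS Mv)
      (split : SplittingMonoids Mv) {ObΔ : Type} {N : ∀ v : (thetaIndex (pilotDataOfK T.D T.K)).V, v ∈ (thetaIndex (pilotDataOfK T.D T.K)).Vbad → Type}
      [∀ v h, Monoid (N v h)] (qData : QPilotData ObΔ N)
      (qK : ∀ v : (thetaIndex (pilotDataOfK T.D T.K)).V, v ∈ (thetaIndex (pilotDataOfK T.D T.K)).Vbad →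
        Set ((logShellsDH (pilotDataOfK T.D T.K) (analyticLogv T.K)).StarPacket v)),
      ¬ Cor312Vol.PilotKummerCompatHull
          (LatticeSituation.ofShells (logShellsDH (pilotDataOfK T.D T.K) (analyticLogv T.K)) M archPk archSub
            (summandPiecesPr (pilotDataOfK T.D T.K) (logvAnalytic_analyticLogv (F := T.K))).Adm
            (summandPiecesPr (pilotDataOfK T.D T.K) (logvAnalytic_analyticLogv (F := T.K))).logvol Ψ act Mmod region frobAdm frobLogvol frobΨ
            frobMmod unitImage ballImage thetaDiv)
          (settingPrVolSharp (pilotDataOfK T.D T.K) (logvAnalytic_analyticLogv (F := T.K)) M archPk archSub Ψ act Mmod region n lat sig split qData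
            (exists_realising_qIdeles_pilotDataOfK T.D).choose (exists_realising_thetaIdeles_pilotDataOfK T.D).choose
            (exists_realising_qIdeles_pilotDataOfK T.D).choose_spec.1 (exists_realising_qIdeles_pilotDataOfK T.D).choose_spec.2.1)
          (fun _ => Cor312.Setting.qRegion
            (settingPrVolSharp (pilotDataOfK T.D T.K) (logvAnalytic_analyticLogv (F := T.K)) M archPk archSub Ψ act Mmod region n lat sig split qData
              (exists_realising_qIdeles_pilotDataOfK T.D).choose (exists_realising_thetaIdeles_pilotDataOfK T.D).choose
              (exists_realising_qIdeles_pilotDataOfK T.D).choose_spec.1 (exists_realising_qIdeles_pilotDataOfK T.D).choose_spec.2.1)) qK := by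
  have habc0 : a * b * c ≠ 0 := by
    obtain ⟨ha, hb, hsum, -⟩ := habc
    exact Nat.mul_ne_zero (Nat.mul_ne_zero ha.ne' hb.ne') (by omega)
  have hvle : v ≤ (a * b * c).factorization (pp : ℕ) := (pp.2.pow_dvd_iff_le_factorization habc0).1 hdvd
  have hord : ∀ u : HeightOneSpectrum (𝓞 ℚ), Rat.HeightOneSpectrum.natGenerator u = (pp : ℕ) →
      ord ℚ u (Cor22.jInv ((a : ℚ) / c)) ≤ -((2 * v : ℕ) : ℤ) := by
    intro u hu
    have hdvd1 : Rat.HeightOneSpectrum.natGenerator u ∣ a * b * c := by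
      rw [hu]; exact (dvd_pow_self _ (by omega)).trans hdvd
    have h2 := Cor22.neg_ord_jInv_ratPoint_triple habc u (by rw [hu]; exact hp2) hdvd1
    rw [hu] at h2
    push_cast at h2 ⊢
    have : (v : ℤ) ≤ ((a * b * c).factorization (pp : ℕ) : ℤ) := by exact_mod_cast hvle
    linarith
  exact GenuineK.not_pilotKummerCompatHull_chosen_ratPoint_of_linUniform T pp hp2 hp3 hp5 hpl B hB (2 * v) (by omega) hord i₀ hil htest

end Summit.ABC.IUTFork.Conditional

end
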